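import Summits.Ventures.PercRepro.ProfilePointedCircuitClassesStarStarF
import Summits.Ventures.PercRepro.ProfilePointedCircuitClassesSevenD

/-!
# PercRepro — `InOutBottomFour` HOLDS: `in_4(e) ≤ out_5(e)` AT EVERY POINT OF EVERY MATROID WITH `#E = ρ + 4`, `ρ ≥ 6`
(p5, gen 41; `proofs/P5-GM1.md` §61)

The assembly.  (1) `ρ = 7`, coloop-free: the bi-independent `4`-sets through `e` and `5`-sets avoiding `e` are the
demands and units of the dual `N✶` (rank `4`, loopless, `11` points), and part IV applies
(`inCount_four_le_outCount_five_of_seven`).  (2) A coloop `x ≠ e`: the demands of `N` are demands of `N ∖ x`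
(every demand avoids `x`, whose complement is a basis) and the units of `N ∖ x` are units of `N` (adding the
coloop `x` to an independent set keeps it independent): `in_4^N(e) ≤ in_4^{N∖x}(e)`,
`out_5^{N∖x}(e) ≤ out_5^N(e)` (`inCount_le_inCount_delete_of_coloop`, `outCount_delete_le_outCount_of_coloop`),
and `N ∖ x` has rank `ρ − 1` and nullity `4`.  (3) Induction on `#E`: a coloop `e` (`in_4(e) = 0`), a coloop
`x ≠ e` with `ρ = 6` (`n = 10`, §59) or `ρ ≥ 7` (delete it), or no coloop at all — `ρ = 6` (§59), `ρ = 7` (this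
file), `ρ ≥ 8` (`StarStar`): **`inOutBottomFour_holds : InOutBottomFour α`**.
-/

open scoped Matroid

namespace PercRepro.Cogirth

open Finset ThmH Skew Shadow Profile

variable {α : Type} [DecidableEq α] {N : Matroid α} [N.Finite]

section SevenE

/-- Bi-independence in `N` is bi-spanning in the dual: for `X ⊆ E`, `X` and `E ∖ X` are independent in `N` iff
both span `N✶`. -/
theorem biIndep_iff_dual_spanning {X : Finset α} (hX : X ⊆ gr N) :
    (rk N X = X.card ∧ rk N (gr N \ X) = (gr N \ X).card) ↔
      (rk (N✶) X = rk (N✶) (gr (N✶)) ∧ rk (N✶) (gr N \ X) = rk (N✶) (gr (N✶))) := by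
  rw [rk_dual_eq_rk_dual_gr_iff hX, rk_dual_eq_rk_dual_gr_iff (sdiff_subset (s := gr N) (t := X)),
    Finset.sdiff_sdiff_eq_self hX]
  exact and_comm

/-- **THE IN–OUT INEQUALITY AT `ρ = 7`** on coloop-free ground sets: `#E = ρ + 4`, `ρ = 7`, no coloops ⟹
`in_4(e) ≤ out_5(e)` for every `e ∈ E`. -/
theorem inCount_four_le_outCount_five_of_seven {e : α} (hn : (gr N).card = rk N (gr N) + 4)
    (hR7 : rk N (gr N) = 7) (hcf : ∀ x ∈ gr N, rk N ((gr N).erase x) = rk N (gr N)) (he : e ∈ gr N) :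
    inCount N 4 e ≤ outCount N 5 e := by
  have hR : rk (N✶) (gr (N✶)) = 4 := by
    rw [gr_dual]
    have := rk_dual_add_rk (M := N)
    omega
  have hll : ∀ x ∈ gr (N✶), rk (N✶) {x} = 1 := by
    intro x hx
    rw [gr_dual] at hx
    have h := (rk_dual_eq_card_iff (singleton_subset_iff.2 hx)).2 (by
      rw [sdiff_singleton_eq_erase]; exact hcf x hx)
    rw [h, card_singleton]
  have h11 : (gr (N✶)).card = 11 := by rw [gr_dual]; omega
  have hed : e ∈ gr (N✶) := by rw [gr_dual]; exact he
  have hmain := card_demands_le_card_units_of_eleven hR hll h11 hed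
  rw [gr_dual] at hmain
  unfold inCount outCount
  have eD : (biIndepSets N 4).filter (fun W => e ∈ W) =
      ((gr N).powersetCard 4).filter (fun W => e ∈ W ∧ rk (N✶) W = 4 ∧ rk (N✶) (gr N \ W) = 4) := by
    ext W
    rw [mem_filter, mem_biIndepSets, mem_filter, mem_powersetCard]
    constructor
    · rintro ⟨⟨hWg, hW4, hWr, hWc⟩, heW⟩
      have h := (biIndep_iff_dual_spanning hWg).1 ⟨hWr, hWc⟩
      rw [hR] at h
      exact ⟨⟨hWg, hW4⟩, heW, h.1, h.2⟩
    · rintro ⟨⟨hWg, hW4⟩, heW, h1, h2⟩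
      have h := (biIndep_iff_dual_spanning hWg).2 (by rw [hR]; exact ⟨h1, h2⟩)
      exact ⟨⟨hWg, hW4, h.1, h.2⟩, heW⟩
  have eU : (biIndepSets N 5).filter (fun W' => e ∉ W') =
      ((gr N).powersetCard 5).filter (fun S => e ∉ S ∧ rk (N✶) S = 4 ∧ rk (N✶) (gr N \ S) = 4) := by
    ext S
    rw [mem_filter, mem_biIndepSets, mem_filter, mem_powersetCard]
    constructor
    · rintro ⟨⟨hSg, hS5, hSr, hSc⟩, heS⟩
      have h := (biIndep_iff_dual_spanning hSg).1 ⟨hSr, hSc⟩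
      rw [hR] at h
      exact ⟨⟨hSg, hS5⟩, heS, h.1, h.2⟩
    · rintro ⟨⟨hSg, hS5⟩, heS, h1, h2⟩
      have h := (biIndep_iff_dual_spanning hSg).2 (by rw [hR]; exact ⟨h1, h2⟩)
      exact ⟨⟨hSg, hS5, h.1, h.2⟩, heS⟩
  rw [eD, eU]
  exact hmain

/-! ### Deleting a coloop -/

/-- A coloop `x` lies outside the closure of every subset of `E − x`. -/
theorem notMem_clF_of_rk_erase_lt {x : α} (hx : x ∈ gr N) (hco : rk N ((gr N).erase x) < rk N (gr N))
    {Z : Finset α} (hZ : Z ⊆ (gr N).erase x) : x ∉ clF N Z := by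
  intro h
  have h1 : x ∈ clF N ((gr N).erase x) := mem_clF_of_subset hZ h
  rw [mem_clF_iff_rk_insert_eq hx (erase_subset x (gr N)), insert_erase hx] at h1
  omega

/-- **The demands survive the deletion of a coloop `x ≠ e`**: every bi-independent `4`-set `W ∋ e` avoids `x`
(the basis `E ∖ W` contains every coloop) and stays bi-independent in `N ∖ x`. -/
theorem inCount_le_inCount_delete_of_coloop {e x : α} (hn : (gr N).card = rk N (gr N) + 4)
    (hco : rk N ((gr N).erase x) < rk N (gr N)) :
    inCount N 4 e ≤ inCount (N ＼ ({x} : Set α)) 4 e := by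
  unfold inCount
  apply card_le_card
  intro W hW
  rw [mem_filter, mem_biIndepSets] at hW
  obtain ⟨⟨hWg, hW4, hWr, hWc⟩, heW⟩ := hW
  have hBcard : (gr N \ W).card = rk N (gr N) := by rw [card_sdiff_of_subset hWg, hn, hW4]; omega
  -- `x ∉ W`
  have hxW : x ∉ W := by
    intro hxW
    have hsub : gr N \ W ⊆ (gr N).erase x := by
      intro g hg
      rw [mem_sdiff] at hg
      exact mem_erase.2 ⟨fun h => hg.2 (h ▸ hxW), hg.1⟩
    have h1 := rk_mono' (M := N) hsub
    omega
  have hWx : W ⊆ (gr N).erase x := fun g hg => mem_erase.2 ⟨fun h => hxW (h ▸ hg), hWg hg⟩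
  rw [mem_filter, mem_biIndepSets, gr_delete']
  refine ⟨⟨hWx, hW4, ?_, ?_⟩, heW⟩
  · rw [rk_delete hWx]; exact hWr
  · have e1 : (gr N).erase x \ W = (gr N \ W).erase x := by
      ext g
      rw [mem_sdiff, mem_erase, mem_erase, mem_sdiff]
      tauto
    rw [e1, rk_delete (erase_subset_erase x sdiff_subset)]
    exact rk_eq_card_of_subset_of_rk_eq_card (erase_subset x (gr N \ W)) hWc

/-- **The units of `N ∖ x` are units of `N`** for a coloop `x`: a bi-independent `5`-set `W' ∌ e` of `N ∖ x` is
bi-independent in `N` (adding the coloop `x` to the independent `E ∖ x ∖ W'` keeps it independent). -/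
theorem outCount_delete_le_outCount_of_coloop {e x : α} (hx : x ∈ gr N)
    (hco : rk N ((gr N).erase x) < rk N (gr N)) :
    outCount (N ＼ ({x} : Set α)) 5 e ≤ outCount N 5 e := by
  unfold outCount
  apply card_le_card
  intro W' hW'
  rw [mem_filter, mem_biIndepSets, gr_delete'] at hW'
  obtain ⟨⟨hW'g, hW'5, hW'r, hW'c⟩, heW'⟩ := hW'
  rw [rk_delete hW'g] at hW'r
  rw [rk_delete (sdiff_subset (s := (gr N).erase x) (t := W'))] at hW'c
  rw [mem_filter, mem_biIndepSets]
  refine ⟨⟨hW'g.trans (erase_subset x (gr N)), hW'5, hW'r, ?_⟩, heW'⟩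
  have hxW' : x ∉ W' := fun h => (mem_erase.1 (hW'g h)).1 rfl
  have e1 : gr N \ W' = insert x ((gr N).erase x \ W') := by
    ext g
    rw [mem_sdiff, mem_insert, mem_sdiff, mem_erase]
    constructor
    · rintro ⟨hg, hgW⟩
      by_cases hgx : g = x
      · exact Or.inl hgx
      · exact Or.inr ⟨⟨hgx, hg⟩, hgW⟩
    · rintro (h | ⟨⟨_, hg⟩, hgW⟩)
      · rw [h]; exact ⟨hx, hxW'⟩
      · exact ⟨hg, hgW⟩
  have hZ : (gr N).erase x \ W' ⊆ (gr N).erase x := sdiff_subset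
  have hxZ : x ∉ (gr N).erase x \ W' := fun h => (mem_erase.1 (mem_sdiff.1 h).1).1 rfl
  rw [e1, rk_insert_eq hx (hZ.trans (erase_subset x (gr N))), if_neg (notMem_clF_of_rk_erase_lt hx hco hZ), hW'c,
    card_insert_of_notMem hxZ]

/-! ### The assembly -/

/-- **`in_4(e) ≤ out_5(e)` on every matroid with `#E = ρ(E) + 4` and `ρ(E) ≥ 6`**, by induction on `#E`: a coloop
`e`, a coloop `x ≠ e` (`ρ = 6`: the `n = 10` theorem; `ρ ≥ 7`: delete `x`), or no coloop (`ρ = 6`, `ρ = 7`,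
`ρ ≥ 8`). -/
theorem inCount_four_le_outCount_five_of_six_le (n : ℕ) :
    ∀ (N : Matroid α) [N.Finite] (e : α), (gr N).card = n → e ∈ gr N → (gr N).card = rk N (gr N) + 4 →
      6 ≤ rk N (gr N) → inCount N 4 e ≤ outCount N 5 e := by
  induction n using Nat.strong_induction_on with
  | _ n ih =>
    intro N _ e hcard he hn hR
    -- `e` a coloop
    by_cases hce : rk N ((gr N).erase e) < rk N (gr N)
    · exact inCount_four_le_outCount_five_of_coloop hn hce
    -- a coloop `x ≠ e`
    by_cases hx : ∃ x ∈ (gr N).erase e, rk N ((gr N).erase x) < rk N (gr N)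
    · obtain ⟨x, hx, hco⟩ := hx
      have hxg : x ∈ gr N := (mem_erase.1 hx).2
      have hxe : x ≠ e := (mem_erase.1 hx).1
      rcases Nat.lt_or_ge (rk N (gr N)) 7 with h6 | h7
      · exact inCount_four_le_outCount_five_of_card_ten hn (by omega) he
      · -- delete `x`
        have hrk : rk N ((gr N).erase x) + 1 = rk N (gr N) := by
          have := rk_le_rk_erase_add_one (M := N) (Subset.refl (gr N)) hxg
          omega
        have h1 := inCount_le_inCount_delete_of_coloop (e := e) hn hco
        have h2 := outCount_delete_le_outCount_of_coloop (e := e) hxg hco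
        have h3 := ih ((gr N).card - 1) (by omega) (N ＼ ({x} : Set α)) e (by
            rw [gr_delete', card_erase_of_mem hxg])
          (by rw [gr_delete']; exact mem_erase.2 ⟨hxe.symm, he⟩)
          (by rw [gr_delete', card_erase_of_mem hxg, rk_delete (Subset.refl _)]; omega)
          (by rw [gr_delete', rk_delete (Subset.refl _)]; omega)
        omega
    -- no coloop at all
    · have hcf : ∀ x ∈ gr N, rk N ((gr N).erase x) = rk N (gr N) := by
        intro x hxg
        have hle := rk_mono' (M := N) (erase_subset x (gr N))
        by_cases hxe : x = e
        · rw [hxe] at hle ⊢; omega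
        · have : ¬ rk N ((gr N).erase x) < rk N (gr N) := fun h => hx ⟨x, mem_erase.2 ⟨hxe, hxg⟩, h⟩
          omega
      rcases Nat.lt_or_ge (rk N (gr N)) 7 with h6 | h7
      · exact inCount_four_le_outCount_five_of_card_ten hn (by omega) he
      rcases Nat.lt_or_ge (rk N (gr N)) 8 with h7' | h8
      · exact inCount_four_le_outCount_five_of_seven hn (by omega) hcf he
      · exact inCount_four_le_outCount_five_of_eight_le hn h8 hcf

/-- **`InOutBottomFour` HOLDS**: on every finite matroid with `#E = ρ(E) + 4` and `ρ(E) ≥ 6`, for every point `e`,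
`in_4(e) ≤ out_5(e)`. -/
theorem inOutBottomFour_holds : InOutBottomFour α := by
  intro N _ e he hn hR
  exact inCount_four_le_outCount_five_of_six_le (gr N).card N e rfl he hn hR

end SevenE

end PercRepro.Cogirth
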